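import Literature.Analysis.Complex.LoewnerMatrixCalculus
import Literature.MathematicalPhysics.QuantumFieldTheory.Balaban1983to89.B5Prop11Lower

/-!
# T⁴ programme, spine node NE2 (U1a), lane P2 — leaf V-REG (1-forms), file 1/4: THE MULTIPLIER-FREE DUALITY LEMMA — at a constrained minimiser of
# a positive-semidefinite Hermitian form `w ↦ w†Kw` on an affine fibre `{Q w = φ}`, the GRADIENT `Kw` is form-bounded,
# `Σ|Kw|² ≤ q·Λ·(w†Kw)`, from a UB-type binder on `Q` (`∀ ν, ∃ λ, Qλ = ν ∧ λ†Kλ ≤ Λ·Σ|ν|²`) and the size bound `Σ|Qv|² ≤ q·Σ|v|²` ALONE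
# (`t4/skeletons/NE2-t4-ne2-p2.md` §2.E row V-REG; cell `pub-balaban`, NE2 formalisation swarm, leaf prover 03 gen 5)

HONEST FRAMING (T4-DAG p. 1).  Rung (B)+1 only — NOT infinite volume, NOT a mass gap, NOT Clay.  NE2 is NOT IN PRINT and NOT proved here.  This file
is GENERIC finite-dimensional linear algebra ([folklore]) in the matrix currency of the road (`Literature.Analysis.Complex.qform`,
`B5Prop11Lower.nsq`); nothing printed is a hypothesis; no `def` at all (the sesquilinear form is written `star v ⬝ᵥ (K *ᵥ w)` throughout); no `sorry`;
axioms standard.  HONEST DEPENDENCY (cell, verbatim): continuum YM on T⁴ ⇐ BetaPertH ∧ nine spine estimates (0/9 proved); BetaPertH ⇐ (D1) ∧ (D4) ∧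
CAP+tail; G-an2-4 gates asym, D1 and NE2/3/4.

WHY A NEW LEMMA.  The scalar leaf REG⁺ (`VariationalCovariantRegularity.nsq_negLap_le_of_isMin`, leaf-09 gen 3) reads the Euler–Lagrange multiplier off
the BLOCK structure of King's one-site-per-digit average `Q_T` (two-point test functions inside a block), and the matrix route of the road owner
(`VariationalKKT.euler_lagrange`, `VariationalCovariantRegLink.rho_minimiser_le`) needs ORTHOGONAL ROWS `Q Qᴴ = c·1`.  Neither ports to the vector sector:
the (1.18) line average `QvL` ([Balaban1985AveragingOperations] (125) SHAPE, leaf-03-g4's `VectorLineTransport.QvL`) SPILLS into the neighbouring block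
(`VectorBlockTrialForm.sum_window`), so its rows overlap and `Q Qᴴ` is not a multiple of the identity.  The lemma below needs neither: it tests the
Euler–Lagrange identity against `λ − Kw ∈ ker Q`, where `λ` is the UB competitor for the datum `Q(Kw)`.

CONTENTS.
 * §1 the sesquilinear form `v†Kw = star v ⬝ᵥ (K *ᵥ w)`: its algebra (`sform_self`, additivity, homogeneity, `conj`-symmetry for Hermitian `K`), the expansion
   `qform K (v + w) = qform K v + qform K w + 2·re (v†Kw)` (`qform_add_vec`);
 * §2 CAUCHY–SCHWARZ for a positive-semidefinite form: `‖v†Kw‖² ≤ (v†Kv)·(w†Kw)` (`norm_sform_sq_le`, discriminant argument, no square root of `K`);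
 * §3 FIRST VARIATION at a constrained minimiser: `Q h = 0 → h†Kw = 0` (`sform_eq_zero_of_isMin`; real and imaginary perturbations);
 * §4 **`nsq_mulVec_le_of_isMin`**: `Σ|Kw|² ≤ q·Λ·qform K w` — THE END; and the `∃`-free reading `re (λ†Kw) = Σ|Kw|²` for any `λ` with `Qλ = Q(Kw)`
   (`re_sform_eq_nsq_of_isMin`).
Consumed by file 2/4 (`VariationalVectorRegularity`: `K := VariationalVectorEffective.KV`, `Q := VariationalVectorTower.QmL`, `q = n^{−d}`).
-/

noncomputable section

open scoped BigOperators ComplexConjugate ComplexOrder Matrix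

namespace Summit.QuantumFields.BalabanUV.T4Continuum.VariationalGradientDuality

open Finset
open Literature.Analysis.Complex (qform)
open Literature.MathematicalPhysics.QuantumFieldTheory.Balaban1983to89.B5Prop11Lower (nsq nsq_nonneg star_dotProduct_self)

variable {ι κ : Type*} [Fintype ι]

/-! ## §1 The sesquilinear polarisation of `qform` -/

/-- on the diagonal the real part of the sesquilinear form `v†(Kw) = star v ⬝ᵥ (K *ᵥ w)` is `qform`. [folklore] -/
theorem sform_self_re (K : Matrix ι ι ℂ) (w : ι → ℂ) : ((star w ⬝ᵥ (K *ᵥ w))).re = qform K w := rfl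

/-- additivity in the second slot. [folklore] -/
theorem sform_add_right (K : Matrix ι ι ℂ) (v w w' : ι → ℂ) : (star v ⬝ᵥ (K *ᵥ (w + w'))) = (star v ⬝ᵥ (K *ᵥ w)) + (star v ⬝ᵥ (K *ᵥ w')) := by
  rw [Matrix.mulVec_add, dotProduct_add]

/-- additivity in the first slot. [folklore] -/
theorem sform_add_left (K : Matrix ι ι ℂ) (v v' w : ι → ℂ) : (star (v + v') ⬝ᵥ (K *ᵥ w)) = (star v ⬝ᵥ (K *ᵥ w)) + (star v' ⬝ᵥ (K *ᵥ w)) := by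
  rw [star_add, add_dotProduct]

/-- subtraction in the first slot. [folklore] -/
theorem sform_sub_left (K : Matrix ι ι ℂ) (v v' w : ι → ℂ) : (star (v - v') ⬝ᵥ (K *ᵥ w)) = (star v ⬝ᵥ (K *ᵥ w)) - (star v' ⬝ᵥ (K *ᵥ w)) := by
  rw [star_sub, sub_dotProduct]

/-- homogeneity in the second slot. [folklore] -/
theorem sform_smul_right (K : Matrix ι ι ℂ) (c : ℂ) (v w : ι → ℂ) : (star v ⬝ᵥ (K *ᵥ (c • w))) = c * (star v ⬝ᵥ (K *ᵥ w)) := by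
  rw [Matrix.mulVec_smul, dotProduct_smul, smul_eq_mul]

/-- conjugate homogeneity in the first slot. [folklore] -/
theorem sform_smul_left (K : Matrix ι ι ℂ) (c : ℂ) (v w : ι → ℂ) : (star (c • v) ⬝ᵥ (K *ᵥ w)) = conj c * (star v ⬝ᵥ (K *ᵥ w)) := by
  rw [star_smul, smul_dotProduct, smul_eq_mul, Complex.star_def]

/-- `conj`-symmetry for a Hermitian matrix: `conj (v†Kw) = w†Kv`. [folklore] -/
theorem conj_sform (K : Matrix ι ι ℂ) (hK : K.IsHermitian) (v w : ι → ℂ) : conj ((star v ⬝ᵥ (K *ᵥ w))) = (star w ⬝ᵥ (K *ᵥ v)) := by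
  show star (star v ⬝ᵥ K *ᵥ w) = _
  rw [← Matrix.star_dotProduct_star, star_star, Matrix.star_mulVec, hK.eq, Matrix.dotProduct_mulVec]

/-- for a Hermitian matrix the diagonal value is real: `w†Kw = qform K w`. [folklore] -/
theorem sform_self (K : Matrix ι ι ℂ) (hK : K.IsHermitian) (w : ι → ℂ) : (star w ⬝ᵥ (K *ᵥ w)) = ((qform K w : ℝ) : ℂ) := by
  have hc : conj ((star w ⬝ᵥ (K *ᵥ w))) = (star w ⬝ᵥ (K *ᵥ w)) := conj_sform K hK w w
  have h := (Complex.conj_eq_iff_re.mp hc).symm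
  rw [h]; rfl

/-- the quadratic expansion `qform K (v + w) = qform K v + qform K w + 2·re (v†Kw)` (Hermitian `K`). [folklore] -/
theorem qform_add_vec (K : Matrix ι ι ℂ) (hK : K.IsHermitian) (v w : ι → ℂ) :
    qform K (v + w) = qform K v + qform K w + 2 * ((star v ⬝ᵥ (K *ᵥ w))).re := by
  have h : (star (v + w) ⬝ᵥ (K *ᵥ (v + w))) = (star v ⬝ᵥ (K *ᵥ v)) + (star w ⬝ᵥ (K *ᵥ w)) + ((star v ⬝ᵥ (K *ᵥ w)) + (star w ⬝ᵥ (K *ᵥ v))) := by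
    rw [sform_add_left, sform_add_right, sform_add_right]; ring
  have hwv : ((star w ⬝ᵥ (K *ᵥ v))).re = ((star v ⬝ᵥ (K *ᵥ w))).re := by
    rw [← conj_sform K hK v w, Complex.conj_re]
  rw [← sform_self_re, h, Complex.add_re, Complex.add_re, Complex.add_re, sform_self_re, sform_self_re, hwv]
  ring

/-- the expansion along a complex multiple: `qform K (v + c•w) = qform K v + ‖c‖²·qform K w + 2·re (c·v†Kw)`. [folklore] -/
theorem qform_add_smul_vec (K : Matrix ι ι ℂ) (hK : K.IsHermitian) (v w : ι → ℂ) (c : ℂ) :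
    qform K (v + c • w) = qform K v + ‖c‖ ^ 2 * qform K w + 2 * (c * (star v ⬝ᵥ (K *ᵥ w))).re := by
  rw [qform_add_vec K hK, sform_smul_right]
  congr 2
  rw [← sform_self_re, ← sform_self_re, sform_smul_left, sform_smul_right, ← mul_assoc, Complex.conj_mul', ← Complex.ofReal_pow,
    Complex.re_ofReal_mul]

/-! ## §2 Cauchy–Schwarz for a positive-semidefinite form -/

/-- a real quadratic that is nonnegative on the whole line has nonpositive reduced discriminant: `(∀ t, 0 ≤ a + 2bt + ct²) → b² ≤ a·c` (for `c ≥ 0`).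
[folklore] -/
theorem sq_le_mul_of_forall_nonneg {a b c : ℝ} (hc : 0 ≤ c) (h : ∀ t : ℝ, 0 ≤ a + 2 * b * t + c * t ^ 2) : b ^ 2 ≤ a * c := by
  have ha : 0 ≤ a := by simpa using h 0
  rcases eq_or_lt_of_le hc with hc0 | hcpos
  · -- `c = 0`: the linear function `a + 2bt` is bounded below only if `b = 0`
    subst hc0
    by_contra hb
    have hb' : b ≠ 0 := by intro h0; exact hb (by rw [h0]; simp)
    have := h (-(a + 1) / (2 * b))
    have e : a + 2 * b * (-(a + 1) / (2 * b)) + 0 * (-(a + 1) / (2 * b)) ^ 2 = -1 := by field_simp; ring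
    linarith [e ▸ this]
  · have := h (-b / c)
    have e : a + 2 * b * (-b / c) + c * (-b / c) ^ 2 = (a * c - b ^ 2) / c := by field_simp; ring
    rw [e] at this
    have := (div_nonneg_iff.mp this).resolve_right (by intro h'; linarith [h'.2])
    linarith [this.1]

/-- **CAUCHY–SCHWARZ FOR A POSITIVE-SEMIDEFINITE FORM**: `‖v†Kw‖² ≤ (v†Kv)·(w†Kw)`. [folklore] -/
theorem norm_sform_sq_le (K : Matrix ι ι ℂ) (hK : K.PosSemidef) (v w : ι → ℂ) :
    ‖(star v ⬝ᵥ (K *ᵥ w))‖ ^ 2 ≤ qform K v * qform K w := by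
  have hH : K.IsHermitian := hK.1
  have hnn : ∀ x : ι → ℂ, 0 ≤ qform K x := fun x => by
    have h0 := hK.dotProduct_mulVec_nonneg x
    exact (Complex.nonneg_iff.mp h0).1
  set B : ℂ := (star v ⬝ᵥ (K *ᵥ w)) with hB
  -- perturb `v` along `conj B • w`: `qform K (v + t•(conj B • w)) = qform v + 2t‖B‖² + t²‖B‖²·qform w ≥ 0`
  have hline : ∀ t : ℝ, 0 ≤ qform K v + 2 * ‖B‖ ^ 2 * t + (‖B‖ ^ 2 * qform K w) * t ^ 2 := by
    intro t
    have h := hnn (v + ((t : ℂ) * conj B) • w)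
    rw [qform_add_smul_vec K hH, ← hB] at h
    have e1 : ‖(t : ℂ) * conj B‖ ^ 2 = t ^ 2 * ‖B‖ ^ 2 := by
      rw [norm_mul, Complex.norm_real, Complex.norm_conj, mul_pow, Real.norm_eq_abs, sq_abs]
    have e2 : ((t : ℂ) * conj B * B).re = t * ‖B‖ ^ 2 := by
      rw [mul_assoc, Complex.conj_mul', ← Complex.ofReal_pow, ← Complex.ofReal_mul, Complex.ofReal_re]
    rw [e1, e2] at h
    nlinarith [h]
  have key := sq_le_mul_of_forall_nonneg (mul_nonneg (sq_nonneg _) (hnn w)) hline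
  -- `‖B‖⁴ ≤ qform v · ‖B‖² · qform w`
  by_cases hB0 : ‖B‖ = 0
  · rw [hB0]; simpa using mul_nonneg (hnn v) (hnn w)
  · have hpos : 0 < ‖B‖ ^ 2 := by positivity
    have : ‖B‖ ^ 2 * ‖B‖ ^ 2 ≤ qform K v * qform K w * ‖B‖ ^ 2 := by nlinarith [key]
    exact le_of_mul_le_mul_right this hpos

/-- the real-part form of Cauchy–Schwarz: `re (v†Kw) ≤ √(v†Kv)·√(w†Kw)`. [folklore] -/
theorem re_sform_le_sqrt_mul_sqrt (K : Matrix ι ι ℂ) (hK : K.PosSemidef) (v w : ι → ℂ) :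
    ((star v ⬝ᵥ (K *ᵥ w))).re ≤ Real.sqrt (qform K v) * Real.sqrt (qform K w) := by
  have hnn : ∀ x : ι → ℂ, 0 ≤ qform K x := fun x => (Complex.nonneg_iff.mp (hK.dotProduct_mulVec_nonneg x)).1
  have h1 : ((star v ⬝ᵥ (K *ᵥ w))).re ≤ ‖(star v ⬝ᵥ (K *ᵥ w))‖ := Complex.re_le_norm _
  have h2 : ‖(star v ⬝ᵥ (K *ᵥ w))‖ ≤ Real.sqrt (qform K v) * Real.sqrt (qform K w) := by
    rw [← Real.sqrt_mul (hnn v), ← Real.sqrt_sq (norm_nonneg _)]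
    exact Real.sqrt_le_sqrt (norm_sform_sq_le K hK v w)
  exact h1.trans h2

/-! ## §3 First variation at a constrained minimiser -/

/-- **FIRST VARIATION**: if `w` minimises `qform K` on the affine fibre `{w′ : Q w′ = φ}` (Hermitian `K`), then `h†Kw = 0` for every `h ∈ ker Q`
(perturb along `t•h` and `(it)•h`). [folklore] -/
theorem sform_eq_zero_of_isMin (K : Matrix ι ι ℂ) (hK : K.IsHermitian) (Q : Matrix κ ι ℂ) {φ : κ → ℂ} {w : ι → ℂ}
    (hw : Q *ᵥ w = φ) (hmin : ∀ w', Q *ᵥ w' = φ → qform K w ≤ qform K w') {h : ι → ℂ} (hh : Q *ᵥ h = 0) :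
    (star h ⬝ᵥ (K *ᵥ w)) = 0 := by
  set B : ℂ := (star w ⬝ᵥ (K *ᵥ h)) with hB
  -- along every complex multiple `c•h` the fibre is preserved
  have hfib : ∀ c : ℂ, Q *ᵥ (w + c • h) = φ := fun c => by
    rw [Matrix.mulVec_add, Matrix.mulVec_smul, hh, smul_zero, add_zero, hw]
  have hquad : ∀ c : ℂ, 0 ≤ ‖c‖ ^ 2 * qform K h + 2 * (c * B).re := fun c => by
    have := hmin _ (hfib c)
    rw [qform_add_smul_vec K hK, ← hB] at this
    linarith
  -- real direction: `re B = 0`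
  have hre : B.re = 0 := by
    have hl : ∀ t : ℝ, 0 ≤ 0 + 2 * B.re * t + qform K h * t ^ 2 := fun t => by
      have := hquad (t : ℂ)
      rw [Complex.norm_real, Real.norm_eq_abs, sq_abs, Complex.re_ofReal_mul] at this
      linarith
    by_cases hq : 0 ≤ qform K h
    · have := sq_le_mul_of_forall_nonneg hq hl
      rw [zero_mul] at this
      exact pow_eq_zero_iff (n := 2) (by norm_num) |>.mp (le_antisymm this (sq_nonneg _))
    · exfalso
      have hq' := not_le.mp hq
      have := hl 1
      have := hl (-1)
      nlinarith
  -- imaginary direction: `im B = 0`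
  have him : B.im = 0 := by
    have hl : ∀ t : ℝ, 0 ≤ 0 + 2 * (-B.im) * t + qform K h * t ^ 2 := fun t => by
      have := hquad ((t : ℂ) * Complex.I)
      have e1 : ‖(t : ℂ) * Complex.I‖ ^ 2 = t ^ 2 := by
        rw [norm_mul, Complex.norm_I, mul_one, Complex.norm_real, Real.norm_eq_abs, sq_abs]
      have e2 : ((t : ℂ) * Complex.I * B).re = -(t * B.im) := by
        rw [mul_assoc, Complex.re_ofReal_mul, Complex.I_mul_re, mul_neg]
      rw [e1, e2] at this
      linarith
    by_cases hq : 0 ≤ qform K h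
    · have := sq_le_mul_of_forall_nonneg hq hl
      rw [zero_mul] at this
      have := pow_eq_zero_iff (n := 2) (by norm_num) |>.mp (le_antisymm this (sq_nonneg _))
      linarith
    · exfalso
      have hq' := not_le.mp hq
      have := hl 1
      have := hl (-1)
      nlinarith
  have hB0 : B = 0 := Complex.ext hre him
  rw [← conj_sform K hK, ← hB, hB0, map_zero]

/-! ## §4 The gradient of a constrained minimiser is form-bounded (multiplier-free duality) -/

/-- **THE PAIRING IDENTITY WITHOUT A MULTIPLIER**: at a constrained minimiser `w`, for ANY `λ` on the fibre of the datum `Q(Kw)` (i.e. `Qλ = Q(Kw)`),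
`re (λ†Kw) = Σ|Kw|²` — because `λ − Kw ∈ ker Q` is orthogonal to `Kw` by the first variation. [folklore] -/
theorem re_sform_eq_nsq_of_isMin (K : Matrix ι ι ℂ) (hK : K.IsHermitian) (Q : Matrix κ ι ℂ) {φ : κ → ℂ} {w : ι → ℂ}
    (hw : Q *ᵥ w = φ) (hmin : ∀ w', Q *ᵥ w' = φ → qform K w ≤ qform K w') {lam : ι → ℂ} (hlam : Q *ᵥ lam = Q *ᵥ (K *ᵥ w)) :
    ((star lam ⬝ᵥ (K *ᵥ w))).re = nsq (K *ᵥ w) := by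
  have hker : Q *ᵥ (lam - K *ᵥ w) = 0 := by rw [Matrix.mulVec_sub, hlam, sub_self]
  have h0 := sform_eq_zero_of_isMin K hK Q hw hmin hker
  rw [sform_sub_left, sub_eq_zero] at h0
  rw [h0, star_dotProduct_self, Complex.ofReal_re]

/-- **THE MULTIPLIER-FREE DUALITY LEMMA (leaf V-REG, file 1/4, END)**: `K` positive semidefinite, `Q` a constraint with `Σ|Qv|² ≤ q·Σ|v|²`, a UB-type
binder `∀ ν, ∃ λ, Qλ = ν ∧ λ†Kλ ≤ Λ·Σ|ν|²`; if `w` minimises `qform K` on `{Q · = φ}` then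

  `Σ_i |(Kw)_i|² ≤ q·Λ·qform K w`.

(`a := Kw`, `λ` the competitor for `Qa`: `Σ|a|² = re λ†Kw ≤ √(λ†Kλ)·√(w†Kw) ≤ √(Λ·q·Σ|a|²)·√(w†Kw)`.)  No orthogonality of the rows of `Q`, no
multiplier, no KKT. [folklore] -/
theorem nsq_mulVec_le_of_isMin [Fintype κ] (K : Matrix ι ι ℂ) (hK : K.PosSemidef) (Q : Matrix κ ι ℂ) {q Λ : ℝ} (hq : 0 ≤ q) (hΛ : 0 ≤ Λ)
    (hQ : ∀ v : ι → ℂ, nsq (Q *ᵥ v) ≤ q * nsq v)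
    (hUB : ∀ ν : κ → ℂ, ∃ lam : ι → ℂ, Q *ᵥ lam = ν ∧ qform K lam ≤ Λ * nsq ν)
    {φ : κ → ℂ} {w : ι → ℂ} (hw : Q *ᵥ w = φ) (hmin : ∀ w', Q *ᵥ w' = φ → qform K w ≤ qform K w') :
    nsq (K *ᵥ w) ≤ q * Λ * qform K w := by
  have hH : K.IsHermitian := hK.1
  have hnn : ∀ x : ι → ℂ, 0 ≤ qform K x := fun x => (Complex.nonneg_iff.mp (hK.dotProduct_mulVec_nonneg x)).1
  set a : ι → ℂ := K *ᵥ w with ha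
  set m : ℝ := nsq a with hm
  have hm0 : 0 ≤ m := nsq_nonneg a
  obtain ⟨lam, hlam, hlamb⟩ := hUB (Q *ᵥ a)
  -- the pairing identity and Cauchy–Schwarz
  have hpair : m = ((star lam ⬝ᵥ (K *ᵥ w))).re := (re_sform_eq_nsq_of_isMin K hH Q hw hmin hlam).symm
  have hcs : m ≤ Real.sqrt (qform K lam) * Real.sqrt (qform K w) := hpair ▸ re_sform_le_sqrt_mul_sqrt K hK lam w
  have hlam' : qform K lam ≤ Λ * q * m := by
    calc qform K lam ≤ Λ * nsq (Q *ᵥ a) := hlamb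
      _ ≤ Λ * (q * m) := mul_le_mul_of_nonneg_left (hQ a) hΛ
      _ = Λ * q * m := by ring
  have hsq : m ^ 2 ≤ Λ * q * m * qform K w := by
    calc m ^ 2 ≤ (Real.sqrt (qform K lam) * Real.sqrt (qform K w)) ^ 2 := pow_le_pow_left₀ hm0 hcs 2
      _ = qform K lam * qform K w := by rw [mul_pow, Real.sq_sqrt (hnn lam), Real.sq_sqrt (hnn w)]
      _ ≤ Λ * q * m * qform K w := mul_le_mul_of_nonneg_right hlam' (hnn w)
  rcases eq_or_lt_of_le hm0 with h0 | hpos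
  · rw [← h0]; exact mul_nonneg (mul_nonneg hq hΛ) (hnn w)
  · have : m * m ≤ q * Λ * qform K w * m := by nlinarith [hsq]
    exact le_of_mul_le_mul_right this hpos

/-- the same for a form presented with a POSITIVE SCALE `c·qform K` as the minimised functional (the fibre minimiser is unchanged). [folklore] -/
theorem nsq_mulVec_le_of_isMin_smul [Fintype κ] (K : Matrix ι ι ℂ) (hK : K.PosSemidef) (Q : Matrix κ ι ℂ) {q Λ c : ℝ} (hq : 0 ≤ q) (hΛ : 0 ≤ Λ)
    (hc : 0 < c) (hQ : ∀ v : ι → ℂ, nsq (Q *ᵥ v) ≤ q * nsq v)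
    (hUB : ∀ ν : κ → ℂ, ∃ lam : ι → ℂ, Q *ᵥ lam = ν ∧ c * qform K lam ≤ Λ * nsq ν)
    {φ : κ → ℂ} {w : ι → ℂ} (hw : Q *ᵥ w = φ) (hmin : ∀ w', Q *ᵥ w' = φ → c * qform K w ≤ c * qform K w') :
    c * nsq (K *ᵥ w) ≤ q * Λ * qform K w := by
  have hUB' : ∀ ν : κ → ℂ, ∃ lam : ι → ℂ, Q *ᵥ lam = ν ∧ qform K lam ≤ Λ / c * nsq ν := fun ν => by
    obtain ⟨lam, h1, h2⟩ := hUB ν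
    refine ⟨lam, h1, ?_⟩
    rw [div_mul_eq_mul_div, le_div_iff₀ hc, mul_comm]
    exact h2
  have hmin' : ∀ w', Q *ᵥ w' = φ → qform K w ≤ qform K w' := fun w' hw' => le_of_mul_le_mul_left (hmin w' hw') hc
  have h := nsq_mulVec_le_of_isMin K hK Q hq (div_nonneg hΛ hc.le) hQ hUB' hw hmin'
  calc c * nsq (K *ᵥ w) ≤ c * (q * (Λ / c) * qform K w) := mul_le_mul_of_nonneg_left h hc.le
    _ = q * Λ * qform K w := by field_simp

end Summit.QuantumFields.BalabanUV.T4Continuum.VariationalGradientDuality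

end
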